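import Mathlib
import Literature.MathematicalPhysics.QuantumFieldTheory.Balaban1983to89.B5Averaging120

/-!
# `Balaban1983to89.B6Eq291Generator` — T. Bałaban, *Propagators and renormalization transformations for lattice gauge
theories. II*, Commun. Math. Phys. **96** (1984) 223–250 [Balaban1984PropagatorsII]: the two-domain generator identity
(2.91) `Δ_aG₀ = I − Σ_{□,□′∈𝒟} K_{□,□′}G_{□′}h_{□′} = I − R` of Sect. C with the kernels (2.92)–(2.93), PROVED as operator
algebra, and the located index slip of (2.93)

statement-level skeleton of published theorems with citation tags; proofs where landed; nothing here is a claim about the Yang–Mills mass gap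

PDF held: `paper:balaban1984-cmp96-propagators-rt-ii` (journal page = PDF page + 222); p. 239 [PDF 17] re-read AS AN IMAGE this
session (`run/shared/lean/pub/pub-balaban/b2b-balaban-ref1/pages/1984-cmp96-propagators-rt-II/1984-cmp96-propagators-rt-II-p017-x2.png`),
p. 229 [PDF 7] and [Balaban1984PropagatorsI] p. 37 (1.120)–(1.121) from the tree transcriptions `…B6Eq239Commutator`,
`…B5Averaging120`.

WHAT IS REPRODUCED.  SKELETON row **B6.Eq2.91** ((2.91)–(2.93) p. 239; cell `lit-balaban`, HOME
`run/shared/lean/pub/lit-balaban/`, Phase-2 seat p02 gen 2 = unit `lit-balaban-p02`, own lane after row B6.Eq2.36 =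
`…B6CoverNested` (2.36); owner r03, referee ref-4; TAKING line HOME/STATUS.md 2026-08-21T03:23:35Z).  Before this file the
identity (2.91) entered the tree ONLY as the hypothesis `h291 : Δa * G0 = 1 - R` of `…B6Prop26.fixedPoint_of_291` /
`prop26_entry_of_291` and as the localisation bookkeeping of `…B6Prop26Gluing`.
p. 239, verbatim: *"On this torus we define operators R, Δ_a as in (2.17), (2.19), but only two scales are present now. …
Let us denote by P_□ the projection operator in (2.17) defined by the above Q′*aQ′, and G_□ = (Δ − ∂P_□∂* + Q*aQ)^{−1}. (2.90)
Both operators are defined on the torus T_□. We form an approximation of G taking as usual G₀ = Σ_{□∈𝒟} h_□G_□h_□. Using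
the formulas (1.126)–(1.128), we get Δ_aG₀ = I − Σ_{□,□′∈𝒟} K_{□,□′}G_{□′}h_{□′} = I − R, (2.91) where
(K_{□,□}A)_μ(x) = Σ_{b∈st(x)} (∂h_□)(b)(∂A_μ)(b) − (Δh_□)(x)A_μ(x) + a(L^jη)^{−2}(S_j*(∂h_□)Q_jA)_μ(x)
− a(L^jη)^{−2}(Q_j*S_j(∂h_□)A)_μ(x) + (ζ_□(∂P∂* − ∂P_□∂*)h_□A)_μ(x) + (ζ_□P_{□,1}(∂h_□)A)_μ(x). (2.92) if x ∈ B^j(Λ_j) (we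
replace the index j above by j+1 if x ∈ B^{j+1}(Λ_{j+1})), (K_{□,□′}A)_μ(x) = (h_□²(1 − ζ_□)∂P∂*h_{□′}A)_μ(x) (2.93) if
□ ≠ □′. The operators S_j, P_{□,1}(∂h_□) = [∂P_□∂*, h_□] were defined in (1.120). The function ζ_□ is of the same type as
h_□, but it is equal to 1 on a cube containing □ and with a boundary having the distance 1/3 M to the boundary of □, and
it is equal to 0 outside a similar cube with 1/3 M replaced by 2/3 M."*  (2.36) p. 229: *"Σ_{□∈𝒟} h_□² = 1"*.

WHAT IS PROVED HERE (0 `sorry`, standard axioms; kind «knitting identity», G.2(b)).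
§1 IN ANY RING OF OPERATORS (`eq291`).  Data per cube □ = `i`: `h i` (h_□), `z i` (ζ_□), `g i` (G_□ transported to the
global space), `m i` (the T_□-version of Δ + Q*aQ, transported), `p i` (∂P_□∂*, transported); global `M` (Δ + Q*aQ) and
`Dg` (∂P∂*), so `Δ_a = M − Dg` ((2.19)) and `Δ_{a,□} = m i − p i` ((2.90)).  Hypotheses = the printed sentences: `hpart`
Σ h_□² = 1 (2.36); `hinv` Δ_{a,□}G_□ = I on T_□ ⊇ supp h_□ ((2.90): `(m i − p i) * g i * h i = h i`); `hagree` Δ + Q*aQ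
agrees with its T_□-version on supp h_□ (p. 239 *"we take … Q*aQ equal to Q*_{j+1}aQ_{j+1} on B^j(Λ), and to Q_j*aQ_j on
T_□∖B^j(Λ)"*: `M * h i = m i * h i`); `hzh`/`hhz` ζ_□ = 1 on supp h_□ (`z i * h i = h i = h i * z i`).  CONCLUSION:
`(M − Dg) * Σ_□ h_□G_□h_□ = 1 − Σ_□ Σ_□′ K_{□,□′} G_□′ h_□′` with `K_{□,□} = (h_□m − mh_□) + ζ_□(Dg − p_□)h_□ + ζ_□(p_□h_□ −
h_□p_□)` — EXACTLY (2.92): its lines 1–2 are the commutator `h_□(Δ + Q*aQ) − (Δ + Q*aQ)h_□` (explicit lattice form = row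
B6.Eq2.39 `…B6Eq239Commutator.laplace_part` per component A_μ, and §3 below for the two-scale averaging part), line 3 is
`ζ_□(∂P∂* − ∂P_□∂*)h_□`, line 4 is `ζ_□[∂P_□∂*, h_□] = ζ_□P_{□,1}(∂h_□)` with the commutator as printed on p. 239 — and with
the off-diagonal kernel `K_{□,□′} = h_□²(1 − ζ_{□′})∂P∂*h_{□′}` (□ ≠ □′).  The mechanism (`one_cube`): Δ_ah_□G_□h_□ =
h_□² − K_{□,□}G_□h_□ − (1 − ζ_□)∂P∂*h_□G_□h_□ after inserting 1 = ζ_□ + (1 − ζ_□) in front of the non-local domain-change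
term and using (1 − ζ_□)h_□ = 0; the far parts are re-expanded with 1 = Σ_□ h_□² on the LEFT (`eq291`), whose □ = □′ term
vanishes (`kOff_self_eq_zero`).  COROLLARIES: `fixedPoint` (G = G₀ + GR, the shape consumed by `…B6Prop26`),
`kDiag_noDomainChange`/`kOff_noDomainChange` ((2.91) ⇒ (2.38) `…B6SectA.generator238` when ζ ≡ 1, P_□ = P).
§1′ THE LOCATED SLIP (print level, not silently corrected; HOME/GAPS.md).  The print's (2.93) carries `(1 − ζ_□)` with the
OUTPUT cube's cut-off; since ζ_□ = 1 on supp h_□, `h_□²(1 − ζ_□) = 0` and the printed off-diagonal kernel VANISHES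
IDENTICALLY (`kOffPrinted_eq_zero`), so (2.91) with (2.92) and the printed (2.93) holds iff the far parts
`Σ_□(1 − ζ_□)∂P∂*h_□G_□h_□` vanish (`eq291_printed_iff`) — false in general: `printed293_fails` is a 2 × 2 integer-matrix
model satisfying every hypothesis above in which the printed identity fails (and `eq291` holds).  The derivation fixes the
index: `ζ_{□′}` (the INPUT cube's cut-off, the one inserted in front of G_{□′}).  Downstream ((2.134)–(2.135),
`…B6Prop26Gluing`) only the left factor h_□² and the right factor h_{□′} are used, so nothing else moves.
§2 THE DICTIONARY (why the ring hypotheses are the printed structure): for a window `E : V_□ → V`, `R : V → V_□` with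
`R ∘ E = id` (cut T_□ = □̃³ out of T_η and paste back), `transport X = E ∘ X ∘ R` is multiplicative, `transport 1 = E ∘ R` is
the window idempotent, and `Δ_{a,□}G_□ = 1` on V_□ plus `(E ∘ R) ∘ h_□ = h_□` give `hinv` (`hinv_of_window`).
§3 LINE 2 OF (2.92) ON THE ℓ² CARRIERS of `…B5Averaging120` with LEVEL-DEPENDENT couplings: for the two-scale averaging
`Q = rectOp q` (rows = blocks of BOTH levels j, j+1) and row weights `w c = a(L^{j(c)}η)^{−2}·τ`, `Q*_wQ := rectAdjW w q ∘
rectOp q` satisfies `h(Q*_wQ) − (Q*_wQ)h = S*_w(∂h)Q − Q*_wS(∂h)` (`gramW_comm`) — the printed `+a(L^jη)^{−2}S_j*(∂h_□)Q_j −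
a(L^jη)^{−2}Q_j*S_j(∂h_□)` with *"j → j+1 on B^{j+1}(Λ_{j+1})"* carried by the row weight; and line 4's operator is
`[kerOp k, mulOp h] = −p1Comm120 k h` (`line4_commutator`; B6 DEFINES P_{□,1}(∂h_□) := [∂P_□∂*, h_□] on p. 239, the
negative of `…B5Averaging120.p1Comm120`'s reading of [B5] (1.120) line 4 — print level, recorded).
HONEST SCOPE.  Operator algebra only: the supports/ranges that make `hagree`, `hzh`, `hinv` true on the lattice (finite
range of Δ and Q*aQ, □ ⊂ {ζ_□ = 1} ⊂ □̃ ⊂ □̃³ = T_□, (2.2)) are the HYPOTHESES, stated as the print states them; no estimate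
((2.133)–(2.135)), no convergence of Σ_n G₀Rⁿ, nothing on d = 4 or the continuum; NOT summit progress.
-/

namespace Literature.MathematicalPhysics.QuantumFieldTheory.Balaban1983to89.B6Eq291Generator

open Finset

/-! ## §1  The generator identity (2.91) with the kernels (2.92)–(2.93), in any ring of operators -/

section Ring

variable {𝔄 : Type*} [Ring 𝔄] {ι : Type*}

/-- **(2.92), the diagonal kernel `K_{□,□}`** in operator form: `(h_□m − mh_□)` (lines 1–2: the commutator of h_□ with
the T_□-version `m` of Δ + Q*aQ, whose lattice form is (2.39)/(1.121)) `+ ζ_□(∂P∂* − ∂P_□∂*)h_□` (line 3, `Dg` = ∂P∂*,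
`p` = ∂P_□∂*) `+ ζ_□[∂P_□∂*, h_□]` (line 4, `P_{□,1}(∂h_□) = [∂P_□∂*, h_□]`).
[cite: Balaban1984PropagatorsII, (2.92) p.239] -/
def kDiag (Dg h z m p : 𝔄) : 𝔄 := (h * m - m * h) + z * (Dg - p) * h + z * (p * h - h * p)

/-- **(2.93), the off-diagonal kernel `K_{□,□′}` (□ ≠ □′), with the index the derivation forces**:
`h_□²(1 − ζ_{□′})∂P∂*h_{□′}` — arguments `hi` = h_□ (output cube), `zj` = ζ_{□′}, `hj` = h_{□′} (input cube).
[cite: Balaban1984PropagatorsII, (2.93) p.239] -/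
def kOff (Dg hi zj hj : 𝔄) : 𝔄 := hi * hi * (1 - zj) * Dg * hj

/-- (2.93) AS PRINTED: `h_□²(1 − ζ_□)∂P∂*h_{□′}` — the cut-off indexed by the OUTPUT cube □ (`zi` = ζ_□).
[cite: Balaban1984PropagatorsII, (2.93) p.239] -/
def kOffPrinted (Dg hi zi hj : 𝔄) : 𝔄 := hi * hi * (1 - zi) * Dg * hj

/-- The family `K_{□,□′}` of (2.91): (2.92) on the diagonal, (2.93) (derived index) off it.
[cite: Balaban1984PropagatorsII, (2.91)–(2.93) p.239] -/
def kFam [DecidableEq ι] (Dg : 𝔄) (h z m p : ι → 𝔄) (i j : ι) : 𝔄 :=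
  if i = j then kDiag Dg (h j) (z j) (m j) (p j) else kOff Dg (h i) (z j) (h j)

/-- The family `K_{□,□′}` with (2.93) read literally as printed.
[cite: Balaban1984PropagatorsII, (2.91)–(2.93) p.239] -/
def kFamPrinted [DecidableEq ι] (Dg : 𝔄) (h z m p : ι → 𝔄) (i j : ι) : 𝔄 :=
  if i = j then kDiag Dg (h j) (z j) (m j) (p j) else kOffPrinted Dg (h i) (z i) (h j)

/-- **`G₀ = Σ_{□∈𝒟} h_□G_□h_□`** (p. 239, the display before (2.91)). [cite: Balaban1984PropagatorsII, (2.90)–(2.91) p.239] -/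
def gZero (s : Finset ι) (h g : ι → 𝔄) : 𝔄 := ∑ j ∈ s, h j * g j * h j

/-- **`R = Σ_{□,□′∈𝒟} K_{□,□′}G_{□′}h_{□′}`** of (2.91). [cite: Balaban1984PropagatorsII, (2.91) p.239] -/
def rOp [DecidableEq ι] (s : Finset ι) (Dg : 𝔄) (h z g m p : ι → 𝔄) : 𝔄 :=
  ∑ i ∈ s, ∑ j ∈ s, kFam Dg h z m p i j * g j * h j

/-- `R` with (2.93) read as printed. [cite: Balaban1984PropagatorsII, (2.91) p.239] -/
def rOpPrinted [DecidableEq ι] (s : Finset ι) (Dg : 𝔄) (h z g m p : ι → 𝔄) : 𝔄 :=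
  ∑ i ∈ s, ∑ j ∈ s, kFamPrinted Dg h z m p i j * g j * h j

/-- The far parts `Σ_□ (1 − ζ_□)∂P∂*h_□G_□h_□` produced by the cut-off insertion (before their re-expansion with
Σ_{□′} h_{□′}² = 1 into the off-diagonal kernels). [cite: Balaban1984PropagatorsII, (2.91)–(2.93) p.239] -/
def farPart (s : Finset ι) (Dg : 𝔄) (h z g : ι → 𝔄) : 𝔄 := ∑ j ∈ s, (1 - z j) * Dg * h j * g j * h j

/-- **The one-cube mechanism behind (2.91)–(2.92).**  With `Δ_a = M − Dg`, `Δ_{a,□} = m − p`: if `Mh = mh` (Δ + Q*aQ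
agrees with its T_□-version on supp h_□), `(m − p)gh = h` (Δ_{a,□}G_□ = I on T_□ ⊇ supp h_□) and `ζh = h`, then
`Δ_a(hG_□h) = h² − K_{□,□}G_□h − (1 − ζ)∂P∂*hG_□h` — commutator, domain change `∂(P − P_□)∂*`, and the insertion
`1 = ζ + (1 − ζ)` with `(1 − ζ)h = 0`. [cite: Balaban1984PropagatorsII, (2.91)–(2.92) p.239] -/
theorem one_cube (M Dg h z g m p : 𝔄) (hagree : M * h = m * h) (hinv : (m - p) * g * h = h) (hzh : z * h = h) :
    (M - Dg) * (h * g * h) = h * h - kDiag Dg h z m p * g * h - (1 - z) * Dg * h * g * h := by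
  have e2 : h * m * g * h = h * h + h * p * g * h := by
    have := congrArg (fun t => h * t) hinv
    simp only [sub_mul, mul_sub] at this
    rw [← sub_eq_iff_eq_add]
    simpa [mul_assoc] using this
  have expand : h * h - kDiag Dg h z m p * g * h - (1 - z) * Dg * h * g * h
      = h * h - h * m * g * h + m * h * g * h + z * h * p * g * h - Dg * h * g * h := by
    simp only [kDiag]
    noncomm_ring
  rw [expand, hzh, e2]
  calc (M - Dg) * (h * g * h) = M * h * g * h - Dg * h * g * h := by noncomm_ring
    _ = m * h * g * h - Dg * h * g * h := by rw [hagree]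
    _ = _ := by noncomm_ring

/-- The □ = □′ term of the re-expanded far part vanishes: `h_□²(1 − ζ_□)∂P∂*h_□ = 0` because `h_□ζ_□ = h_□` (ζ_□ = 1 on
supp h_□, p. 239) — which is why (2.91) carries no □ = □′ off-diagonal kernel. [cite: Balaban1984PropagatorsII, (2.93) p.239] -/
theorem kOff_self_eq_zero {Dg h z : 𝔄} (hhz : h * z = h) : kOff Dg h z h = 0 := by
  have : h * h * (1 - z) = 0 := by
    rw [mul_sub, mul_one, mul_assoc, hhz, sub_self]
  simp only [kOff, this, zero_mul]

/-- **The printed off-diagonal kernel (2.93) vanishes identically**: `h_□²(1 − ζ_□)∂P∂*h_{□′} = 0` for EVERY □′, because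
the cut-off printed is the output cube's and ζ_□ = 1 on supp h_□. [cite: Balaban1984PropagatorsII, (2.93) p.239] -/
theorem kOffPrinted_eq_zero {Dg hi zi : 𝔄} (hj : 𝔄) (hhz : hi * zi = hi) : kOffPrinted Dg hi zi hj = 0 := by
  have : hi * hi * (1 - zi) = 0 := by
    rw [mul_sub, mul_one, mul_assoc, hhz, sub_self]
  simp only [kOffPrinted, this, zero_mul]

/-- Step 1 of (2.91): summing `one_cube` over 𝒟 and using Σ h_□² = 1,
`Δ_aG₀ = 1 − Σ_□ K_{□,□}G_□h_□ − Σ_□ (1 − ζ_□)∂P∂*h_□G_□h_□`. [cite: Balaban1984PropagatorsII, (2.91) p.239] -/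
theorem eq291_far (s : Finset ι) (M Dg : 𝔄) (h z g m p : ι → 𝔄)
    (hpart : ∑ i ∈ s, h i * h i = 1) (hagree : ∀ i ∈ s, M * h i = m i * h i)
    (hinv : ∀ i ∈ s, (m i - p i) * g i * h i = h i) (hzh : ∀ i ∈ s, z i * h i = h i) :
    (M - Dg) * gZero s h g
      = 1 - ∑ j ∈ s, kDiag Dg (h j) (z j) (m j) (p j) * g j * h j - farPart s Dg h z g := by
  unfold gZero farPart
  have hsum : ∑ j ∈ s, (M - Dg) * (h j * g j * h j)
      = ∑ j ∈ s, (h j * h j - kDiag Dg (h j) (z j) (m j) (p j) * g j * h j - (1 - z j) * Dg * h j * g j * h j) :=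
    Finset.sum_congr rfl fun j hj => one_cube M Dg (h j) (z j) (g j) (m j) (p j) (hagree j hj) (hinv j hj) (hzh j hj)
  rw [Finset.mul_sum, hsum, Finset.sum_sub_distrib, Finset.sum_sub_distrib, hpart]

/-- Step 2 of (2.91): the far parts re-expanded with `1 = Σ_□ h_□²` on the left are the off-diagonal kernels,
`Σ_{□′}(1 − ζ_{□′})∂P∂*h_{□′}G_{□′}h_{□′} = Σ_□ Σ_{□′} h_□²(1 − ζ_{□′})∂P∂*h_{□′}·G_{□′}h_{□′}` (all pairs; the □ = □′ terms are
zero by `kOff_self_eq_zero`). [cite: Balaban1984PropagatorsII, (2.91)–(2.93) p.239] -/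
theorem farPart_eq_sum_kOff (s : Finset ι) (Dg : 𝔄) (h z g : ι → 𝔄) (hpart : ∑ i ∈ s, h i * h i = 1) :
    farPart s Dg h z g = ∑ i ∈ s, ∑ j ∈ s, kOff Dg (h i) (z j) (h j) * g j * h j := by
  unfold farPart
  calc ∑ j ∈ s, (1 - z j) * Dg * h j * g j * h j
      = ∑ j ∈ s, (∑ i ∈ s, h i * h i) * ((1 - z j) * Dg * h j * g j * h j) := by
        rw [hpart]
        simp only [one_mul]
    _ = ∑ j ∈ s, ∑ i ∈ s, h i * h i * ((1 - z j) * Dg * h j * g j * h j) := by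
        simp_rw [Finset.sum_mul]
    _ = ∑ i ∈ s, ∑ j ∈ s, h i * h i * ((1 - z j) * Dg * h j * g j * h j) := Finset.sum_comm
    _ = _ := by
        refine Finset.sum_congr rfl fun i _ => Finset.sum_congr rfl fun j _ => ?_
        simp only [kOff, mul_assoc]

/-- **(2.91) PROVED: `Δ_aG₀ = I − Σ_{□,□′∈𝒟} K_{□,□′}G_{□′}h_{□′} = I − R`** with `K_{□,□}` = (2.92) and `K_{□,□′}` = (2.93)
(derived index ζ_{□′}), in any ring, from: Σ_□ h_□² = 1 (2.36); Δ + Q*aQ = its T_□-version on supp h_□; Δ_{a,□}G_□ = I on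
T_□ ⊇ supp h_□ (2.90); ζ_□ = 1 on supp h_□.  *"Using the formulas (1.126)–(1.128), we get (2.91)"*.
[cite: Balaban1984PropagatorsII, (2.91) p.239] -/
theorem eq291 [DecidableEq ι] (s : Finset ι) (M Dg : 𝔄) (h z g m p : ι → 𝔄)
    (hpart : ∑ i ∈ s, h i * h i = 1) (hagree : ∀ i ∈ s, M * h i = m i * h i)
    (hinv : ∀ i ∈ s, (m i - p i) * g i * h i = h i)
    (hzh : ∀ i ∈ s, z i * h i = h i) (hhz : ∀ i ∈ s, h i * z i = h i) :
    (M - Dg) * gZero s h g = 1 - rOp s Dg h z g m p := by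
  rw [eq291_far s M Dg h z g m p hpart hagree hinv hzh, farPart_eq_sum_kOff s Dg h z g hpart, sub_sub]
  congr 1
  have diag : ∑ j ∈ s, kDiag Dg (h j) (z j) (m j) (p j) * g j * h j
      = ∑ i ∈ s, ∑ j ∈ s, (if i = j then kDiag Dg (h j) (z j) (m j) (p j) * g j * h j else 0) := by
    refine (Finset.sum_congr rfl fun i hi => ?_).symm
    rw [Finset.sum_ite_eq, if_pos hi]
  have split : ∀ i ∈ s, ∀ j ∈ s, kFam Dg h z m p i j * g j * h j
      = (if i = j then kDiag Dg (h j) (z j) (m j) (p j) * g j * h j else 0) + kOff Dg (h i) (z j) (h j) * g j * h j := by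
    intro i hi j _
    unfold kFam
    split_ifs with hij
    · subst hij
      rw [kOff_self_eq_zero (hhz i hi), zero_mul, zero_mul, add_zero]
    · rw [zero_add]
  unfold rOp
  rw [Finset.sum_congr rfl fun i hi => Finset.sum_congr rfl fun j hj => split i hi j hj, diag,
    ← Finset.sum_add_distrib]
  exact Finset.sum_congr rfl fun i _ => Finset.sum_add_distrib.symm

/-- **(2.91) in the expanded form** `Δ_a Σ_□ h_□G_□h_□ = 1 − Σ_□Σ_{□′} K_{□,□′}G_{□′}h_{□′}` (definitions unfolded).
[cite: Balaban1984PropagatorsII, (2.91) p.239] -/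
theorem eq291_sum [DecidableEq ι] (s : Finset ι) (M Dg : 𝔄) (h z g m p : ι → 𝔄)
    (hpart : ∑ i ∈ s, h i * h i = 1) (hagree : ∀ i ∈ s, M * h i = m i * h i)
    (hinv : ∀ i ∈ s, (m i - p i) * g i * h i = h i)
    (hzh : ∀ i ∈ s, z i * h i = h i) (hhz : ∀ i ∈ s, h i * z i = h i) :
    (M - Dg) * ∑ j ∈ s, h j * g j * h j = 1 - ∑ i ∈ s, ∑ j ∈ s, kFam Dg h z m p i j * g j * h j :=
  eq291 s M Dg h z g m p hpart hagree hinv hzh hhz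

/-- **The fixed-point form** used downstream (p. 247, *"Reasoning in the same way as in the proof of Proposition 2.2"*;
`…B6Prop26.fixedPoint_of_291`): if `G` is a left inverse of `Δ_a` then (2.91) gives `G = G₀ + GR`.
[cite: Balaban1984PropagatorsII, (2.91) p.239] -/
theorem fixedPoint {Da G G0 R : 𝔄} (hG : G * Da = 1) (h291 : Da * G0 = 1 - R) : G = G0 + G * R := by
  have e : G * (Da * G0) = G * (1 - R) := by rw [h291]
  rw [← mul_assoc, hG, one_mul, mul_sub, mul_one] at e
  rw [e, sub_add_cancel]

/-- `G = G₀ + GR` for the concrete `G₀`, `R` of (2.91). [cite: Balaban1984PropagatorsII, (2.91) p.239] -/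
theorem fixedPoint_eq291 [DecidableEq ι] (s : Finset ι) (M Dg G : 𝔄) (h z g m p : ι → 𝔄)
    (hG : G * (M - Dg) = 1)
    (hpart : ∑ i ∈ s, h i * h i = 1) (hagree : ∀ i ∈ s, M * h i = m i * h i)
    (hinv : ∀ i ∈ s, (m i - p i) * g i * h i = h i)
    (hzh : ∀ i ∈ s, z i * h i = h i) (hhz : ∀ i ∈ s, h i * z i = h i) :
    G = gZero s h g + G * rOp s Dg h z g m p :=
  fixedPoint hG (eq291 s M Dg h z g m p hpart hagree hinv hzh hhz)

/-- NO DOMAIN CHANGE: with `ζ_□ = 1` and `P_□ = P` the diagonal kernel (2.92) is the single commutator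
`h_□Δ_a − Δ_ah_□ = K(h_□)` of (2.38) (`…B6SectA.generator238`, `…B6Eq250.kOp`). [cite: Balaban1984PropagatorsII, (2.38) p.229 + (2.92) p.239] -/
theorem kDiag_noDomainChange (M Dg h : 𝔄) : kDiag Dg h 1 M Dg = h * (M - Dg) - (M - Dg) * h := by
  simp only [kDiag]
  noncomm_ring

/-- NO DOMAIN CHANGE: with `ζ ≡ 1` the off-diagonal kernels (2.93) vanish, so (2.91) collapses to (2.38).
[cite: Balaban1984PropagatorsII, (2.38) p.229 + (2.93) p.239] -/
theorem kOff_noDomainChange (Dg hi hj : 𝔄) : kOff Dg hi 1 hj = 0 := by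
  simp [kOff]

/-! ### §1′  The located slip of (2.93): with the printed index the off-diagonal kernels vanish identically -/

/-- With (2.93) as printed, `R` reduces to its diagonal part `Σ_□ K_{□,□}G_□h_□`.
[cite: Balaban1984PropagatorsII, (2.93) p.239] -/
theorem rOpPrinted_eq_diag [DecidableEq ι] (s : Finset ι) (Dg : 𝔄) (h z g m p : ι → 𝔄)
    (hhz : ∀ i ∈ s, h i * z i = h i) :
    rOpPrinted s Dg h z g m p = ∑ j ∈ s, kDiag Dg (h j) (z j) (m j) (p j) * g j * h j := by
  unfold rOpPrinted
  have split : ∀ i ∈ s, ∀ j ∈ s, kFamPrinted Dg h z m p i j * g j * h j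
      = (if i = j then kDiag Dg (h j) (z j) (m j) (p j) * g j * h j else 0) := by
    intro i hi j _
    unfold kFamPrinted
    split_ifs with hij
    · rfl
    · rw [kOffPrinted_eq_zero (h j) (hhz i hi), zero_mul, zero_mul]
  rw [Finset.sum_congr rfl fun i hi => Finset.sum_congr rfl fun j hj => split i hi j hj]
  refine Finset.sum_congr rfl fun i hi => ?_
  rw [Finset.sum_ite_eq, if_pos hi]

/-- **(2.91) WITH (2.93) AS PRINTED holds iff the far parts vanish**: under the hypotheses of `eq291`,
`Δ_aG₀ = 1 − Σ_{□,□′}K^{printed}_{□,□′}G_{□′}h_{□′}  ↔  Σ_□ (1 − ζ_□)∂P∂*h_□G_□h_□ = 0`.  The print's `(1 − ζ_□)` in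
(2.93) is an index slip for `(1 − ζ_{□′})` (HOME/GAPS.md; `printed293_fails` below). [cite: Balaban1984PropagatorsII, (2.91)–(2.93) p.239] -/
theorem eq291_printed_iff [DecidableEq ι] (s : Finset ι) (M Dg : 𝔄) (h z g m p : ι → 𝔄)
    (hpart : ∑ i ∈ s, h i * h i = 1) (hagree : ∀ i ∈ s, M * h i = m i * h i)
    (hinv : ∀ i ∈ s, (m i - p i) * g i * h i = h i)
    (hzh : ∀ i ∈ s, z i * h i = h i) (hhz : ∀ i ∈ s, h i * z i = h i) :
    (M - Dg) * gZero s h g = 1 - rOpPrinted s Dg h z g m p ↔ farPart s Dg h z g = 0 := by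
  rw [eq291_far s M Dg h z g m p hpart hagree hinv hzh, rOpPrinted_eq_diag s Dg h z g m p hhz]
  constructor
  · intro e
    have := congrArg (fun t => 1 - (∑ j ∈ s, kDiag Dg (h j) (z j) (m j) (p j) * g j * h j) - t) e
    simpa using this
  · intro e
    rw [e, sub_zero]

end Ring

/-! ### §1″  A two-cube integer-matrix model: every hypothesis of `eq291` holds, the printed reading of (2.93) fails -/

section Witness

open Matrix

/-- Toy model, cube 0: `h₀ = diag(1,0)`. [folklore] -/
def th : Fin 2 → Matrix (Fin 2) (Fin 2) ℤ := ![!![1, 0; 0, 0], !![0, 0; 0, 1]]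

/-- Toy model: the non-local operator `∂P∂*` ↦ the flip `!![0,1;1,0]`. [folklore] -/
def tDg : Matrix (Fin 2) (Fin 2) ℤ := !![0, 1; 1, 0]

/-- **The printed (2.93) is not an identity**: in the ring of 2 × 2 integer matrices with two "cubes" `h₀ = diag(1,0)`,
`h₁ = diag(0,1)` (Σ h² = 1), `ζ_□ = h_□` (ζ_□h_□ = h_□ = h_□ζ_□), `M = m_□ = G_□ = 1`, `P_□ = 0` (so `Mh = mh`,
`Δ_{a,□}G_□h_□ = h_□`) and `∂P∂* = !![0,1;1,0]`, ALL hypotheses of `eq291` hold, (2.91) with the derived (2.93) holds, and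
(2.91) with the PRINTED (2.93) FAILS (the far part equals `∂P∂* ≠ 0`). [cite: Balaban1984PropagatorsII, (2.93) p.239] -/
theorem printed293_fails :
    (∑ i ∈ (Finset.univ : Finset (Fin 2)), th i * th i = 1) ∧
    ((1 - tDg) * gZero Finset.univ th (fun _ => 1) = 1 - rOp Finset.univ tDg th th (fun _ => 1) (fun _ => 1) (fun _ => 0)) ∧
    ¬ ((1 - tDg) * gZero Finset.univ th (fun _ => 1)
        = 1 - rOpPrinted Finset.univ tDg th th (fun _ => 1) (fun _ => 1) (fun _ => 0)) := by
  have hpart : ∑ i ∈ (Finset.univ : Finset (Fin 2)), th i * th i = 1 := by decide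
  have hagree : ∀ i ∈ (Finset.univ : Finset (Fin 2)), (1 : Matrix (Fin 2) (Fin 2) ℤ) * th i = 1 * th i := fun _ _ => rfl
  have hinv : ∀ i ∈ (Finset.univ : Finset (Fin 2)), ((1 : Matrix (Fin 2) (Fin 2) ℤ) - 0) * 1 * th i = th i := by
    intro i _
    simp
  have hzh : ∀ i ∈ (Finset.univ : Finset (Fin 2)), th i * th i = th i := by decide
  refine ⟨hpart, eq291 _ _ _ _ _ _ _ _ hpart hagree hinv hzh hzh, ?_⟩
  rw [eq291_printed_iff _ _ _ _ _ _ _ _ hpart hagree hinv hzh hzh]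
  unfold farPart
  decide

end Witness

/-! ## §2  The dictionary: transported torus operators and the window idempotent -/

section Transport

variable {R : Type*} [CommRing R] {V W : Type*} [AddCommGroup V] [Module R V] [AddCommGroup W] [Module R W]

/-- Transport of an operator `X` on the local space `W` = fields on `T_□` to the global space `V` = fields on `T_η`
along a window (`E` = paste, `Rr` = cut): `E ∘ X ∘ Rr`.  This is how `h_□G_□h_□`, `∂P_□∂*`, the T_□-version of Δ + Q*aQ
act in (2.91). [cite: Balaban1984PropagatorsII, (2.89)–(2.91) pp.238–239] -/
def transport (E : W →ₗ[R] V) (Rr : V →ₗ[R] W) (X : Module.End R W) : Module.End R V := E ∘ₗ X ∘ₗ Rr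

/-- Transport is multiplicative when `Rr ∘ E = id` (cutting what was just pasted gives it back). [folklore] -/
private theorem transport_mul (E : W →ₗ[R] V) (Rr : V →ₗ[R] W) (hRE : Rr ∘ₗ E = LinearMap.id) (X Y : Module.End R W) :
    transport E Rr X * transport E Rr Y = transport E Rr (X * Y) := by
  apply LinearMap.ext
  intro v
  have hre : Rr (E (Y (Rr v))) = Y (Rr v) := by simpa using LinearMap.congr_fun hRE (Y (Rr v))
  simp only [transport, Module.End.mul_apply, LinearMap.coe_comp, Function.comp_apply, hre]

/-- Transport is subtractive. [folklore] -/
private theorem transport_sub (E : W →ₗ[R] V) (Rr : V →ₗ[R] W) (X Y : Module.End R W) :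
    transport E Rr (X - Y) = transport E Rr X - transport E Rr Y := by
  simp only [transport, LinearMap.sub_comp, LinearMap.comp_sub]

/-- `transport 1 = E ∘ Rr`, the window idempotent. [folklore] -/
private theorem transport_one (E : W →ₗ[R] V) (Rr : V →ₗ[R] W) : transport E Rr 1 = E ∘ₗ Rr := by
  simp only [transport, Module.End.one_eq_id, LinearMap.id_comp]

/-- **`hinv` from the printed structure**: if `Δ_{a,□}G_□ = 1` on the torus T_□ ((2.90): G_□ is THE inverse there) and
h_□ is supported inside the window (`(E ∘ Rr) ∘ h_□ = h_□`), then for the transported operators `m − p := transport Δ_{a,□}`,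
`g := transport G_□`: `(m − p) * g * h_□ = h_□`. [cite: Balaban1984PropagatorsII, (2.90)–(2.91) p.239] -/
theorem hinv_of_window (E : W →ₗ[R] V) (Rr : V →ₗ[R] W) (hRE : Rr ∘ₗ E = LinearMap.id)
    (Dloc Gloc : Module.End R W) (hGloc : Dloc * Gloc = 1) (H : Module.End R V) (hwin : (E ∘ₗ Rr) ∘ₗ H = H) :
    transport E Rr Dloc * transport E Rr Gloc * H = H := by
  rw [transport_mul E Rr hRE, hGloc, transport_one, Module.End.mul_eq_comp, hwin]

/-- The transported generator splits as the print writes it: `transport(m_loc − p_loc) = transport m_loc − transport p_loc`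
(`m_loc` = Δ + Q*aQ on T_□, `p_loc` = ∂P_□∂*), so `hinv_of_window` is the hypothesis `hinv` of `eq291` verbatim.
[cite: Balaban1984PropagatorsII, (2.90)–(2.91) p.239] -/
theorem hinv_of_window' (E : W →ₗ[R] V) (Rr : V →ₗ[R] W) (hRE : Rr ∘ₗ E = LinearMap.id)
    (mloc ploc Gloc : Module.End R W) (hGloc : (mloc - ploc) * Gloc = 1) (H : Module.End R V)
    (hwin : (E ∘ₗ Rr) ∘ₗ H = H) :
    (transport E Rr mloc - transport E Rr ploc) * transport E Rr Gloc * H = H := by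
  rw [← transport_sub]
  exact hinv_of_window E Rr hRE (mloc - ploc) Gloc hGloc H hwin

end Transport

/-! ## §3  Lines 2 and 4 of (2.92) on the ℓ² carriers of `…B5Averaging120` (two-scale averaging with row weights) -/

section Lines

open B5TorusPartition (mulOp mulOp_apply)
open B5Commutator128 (kerOp)
open B5Averaging120 (rectOp rectOp_apply rectOp_comp_mulOp mulOp_comp_rectOp rectOp_add rectOp_sub sComm120 p1Comm120
  kerOp_mulOp_eq)

variable {ι κ : Type} [Fintype ι] [Fintype κ]

/-- The ROW-WEIGHTED adjoint `Q*_w` of the two-scale averaging `Q = rectOp q` (rows `c` = blocks of BOTH levels present on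
T_□): kernel `w c · q c i`, `w c = a·(L^{j(c)}η)^{−2}·(pairing weight)` — p. 239 *"Q*aQ equal to Q*_{j+1}aQ_{j+1} on B^j(Λ),
and to Q_j*aQ_j on T_□∖B^j(Λ)"* and (2.92) *"we replace the index j above by j+1 if x ∈ B^{j+1}(Λ_{j+1})"*.
[cite: Balaban1984PropagatorsII, (2.89)–(2.92) p.239] -/
noncomputable def rectAdjW (w : κ → ℝ) (q : κ → ι → ℝ) : EuclideanSpace ℝ κ →ₗ[ℝ] EuclideanSpace ℝ ι :=
  rectOp fun i c => w c * q c i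

/-- The row-weighted `S*_w(∂h)`: kernel `w c · q c i · (h i − hc c)` ([B5] (1.120) line 3, per level).
[cite: Balaban1984PropagatorsII, (2.92) p.239] -/
noncomputable def sAdjW (w : κ → ℝ) (q : κ → ι → ℝ) (h : ι → ℝ) (hc : κ → ℝ) :
    EuclideanSpace ℝ κ →ₗ[ℝ] EuclideanSpace ℝ ι :=
  rectOp fun i c => w c * (q c i * (h i - hc c))

omit [Fintype ι] in
/-- `Q*_w ∘ h_c = h ∘ Q*_w − S*_w(∂h)` (the weighted form of [B5] (1.120) line 3, first half). [cite: Balaban1984PropagatorsI, (1.120) p.37] -/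
theorem rectAdjW_mulOp (w : κ → ℝ) (q : κ → ι → ℝ) (h : ι → ℝ) (hc : κ → ℝ) :
    rectAdjW w q ∘ₗ mulOp hc = mulOp h ∘ₗ rectAdjW w q - sAdjW w q h hc := by
  unfold rectAdjW sAdjW
  rw [rectOp_comp_mulOp, mulOp_comp_rectOp, ← rectOp_sub]
  congr 1
  funext i c
  ring

/-- **Line 2 of (2.92)**: for the two-scale `Q*aQ := Q*_wQ`,
`h(Q*_wQ) − (Q*_wQ)h = S*_w(∂h)Q − Q*_wS(∂h)` — the printed `+ a(L^jη)^{−2}(S_j*(∂h_□)Q_jA) − a(L^jη)^{−2}(Q_j*S_j(∂h_□)A)`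
with the level of the block through `x` selecting the coupling (row weight `w`). [cite: Balaban1984PropagatorsII, (2.92) p.239] -/
theorem gramW_comm (w : κ → ℝ) (q : κ → ι → ℝ) (h : ι → ℝ) (hc : κ → ℝ) :
    mulOp h ∘ₗ (rectAdjW w q ∘ₗ rectOp q) - (rectAdjW w q ∘ₗ rectOp q) ∘ₗ mulOp h
      = sAdjW w q h hc ∘ₗ rectOp q - rectAdjW w q ∘ₗ sComm120 q h hc := by
  have e : (rectAdjW w q ∘ₗ rectOp q) ∘ₗ mulOp h
      = mulOp h ∘ₗ (rectAdjW w q ∘ₗ rectOp q) - sAdjW w q h hc ∘ₗ rectOp q + rectAdjW w q ∘ₗ sComm120 q h hc := by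
    calc (rectAdjW w q ∘ₗ rectOp q) ∘ₗ mulOp h
        = rectAdjW w q ∘ₗ (rectOp q ∘ₗ mulOp h) := by rw [LinearMap.comp_assoc]
      _ = rectAdjW w q ∘ₗ (mulOp hc ∘ₗ rectOp q + sComm120 q h hc) := by rw [B5Averaging120.rectOp_mulOp q h hc]
      _ = (rectAdjW w q ∘ₗ mulOp hc) ∘ₗ rectOp q + rectAdjW w q ∘ₗ sComm120 q h hc := by
          rw [LinearMap.comp_add, LinearMap.comp_assoc]
      _ = (mulOp h ∘ₗ rectAdjW w q - sAdjW w q h hc) ∘ₗ rectOp q + rectAdjW w q ∘ₗ sComm120 q h hc := by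
          rw [rectAdjW_mulOp w q h hc]
      _ = _ := by rw [LinearMap.sub_comp, LinearMap.comp_assoc]
  rw [e]
  abel

/-- Line 2 of (2.92) at a site `x` (component `A_μ` ↦ `v`): `(S*_w(∂h)Qv)(x) − (Q*_wS(∂h)v)(x)
= Σ_c w_c q(c,x)(h(x) − h(c))·(Qv)(c) − Σ_c w_c q(c,x)·(S(∂h)v)(c)` with `(S(∂h)v)(c) = Σ_{x′} q(c,x′)(h(x′) − h(c))v(x′)`
— the contour sums `(∂h)(Γ_{c,x,x′})` of [B5] (1.120) telescoped to differences of h. [cite: Balaban1984PropagatorsII, (2.92) p.239] -/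
theorem line2_apply (w : κ → ℝ) (q : κ → ι → ℝ) (h : ι → ℝ) (hc : κ → ℝ) (v : EuclideanSpace ℝ ι) (x : ι) :
    (sAdjW w q h hc ∘ₗ rectOp q - rectAdjW w q ∘ₗ sComm120 q h hc) v x
      = (∑ c, w c * (q c x * (h x - hc c)) * ∑ x', q c x' * v x')
        - ∑ c, w c * q c x * ∑ x', q c x' * (h x' - hc c) * v x' := by
  simp only [sAdjW, rectAdjW, sComm120, LinearMap.sub_apply, LinearMap.coe_comp, Function.comp_apply, PiLp.sub_apply,
    rectOp_apply]

/-- **Line 4 of (2.92), the operator**: B6 defines `P_{□,1}(∂h_□) := [∂P_□∂*, h_□]` (p. 239); for a kernel operator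
`∂P_□∂* = kerOp k` this commutator is `−p1Comm120 k h` of `…B5Averaging120` (whose `p1Comm120` reads [B5] (1.120) line 4
as `h∂P∂* − ∂P∂*h`), i.e. the kernel `(h(x′) − h(x))k(x,x′)`. [cite: Balaban1984PropagatorsII, (2.92) p.239] -/
theorem line4_commutator (k : ι → ι → ℝ) (h : ι → ℝ) :
    kerOp k * mulOp h - mulOp h * kerOp k = -p1Comm120 k h := by
  rw [kerOp_mulOp_eq k h]
  abel

/-- Line 4's kernel: `([∂P_□∂*, h]v)(x) = Σ_{x′} (h(x′) − h(x))·k(x,x′)·v(x′)` — the printed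
`Σ_{x′,ν}(∂h)(Γ_{x,x′})(∂P_□∂*)_{μν}(x,x′)A_ν(x′)` with the contour sum telescoped. [cite: Balaban1984PropagatorsII, (2.92) p.239] -/
theorem line4_apply (k : ι → ι → ℝ) (h : ι → ℝ) (v : EuclideanSpace ℝ ι) (x : ι) :
    (kerOp k * mulOp h - mulOp h * kerOp k) v x = ∑ x', (h x' - h x) * k x x' * v x' := by
  simp only [LinearMap.sub_apply, Module.End.mul_apply, B5Commutator128.kerOp_apply, mulOp_apply, Finset.mul_sum,
    PiLp.sub_apply, ← Finset.sum_sub_distrib]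
  exact Finset.sum_congr rfl fun x' _ => by ring

/-- **(2.92) lines 1–2 + 4 assembled on one carrier** (all of T_□'s sites and components flattened into `ι`): with
`m := L + Q*_wQ` (L = Δ acting componentwise; its commutator's lattice form is `…B6Eq239Commutator.laplace_part`) and
`p := kerOp k` (= ∂P_□∂*), the operator part `(h m − m h) + ζ(p h − h p)` of `kDiag` equals
`(hL − Lh) + (S*_w(∂h)Q − Q*_wS(∂h)) − ζ·p1Comm120 k h`. [cite: Balaban1984PropagatorsII, (2.92) p.239] -/
theorem kDiag_lines (L : Module.End ℝ (EuclideanSpace ℝ ι)) (k : ι → ι → ℝ) (w : κ → ℝ) (q : κ → ι → ℝ)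
    (h ζ : ι → ℝ) (hc : κ → ℝ) (Dg : Module.End ℝ (EuclideanSpace ℝ ι)) :
    kDiag Dg (mulOp h) (mulOp ζ) (L + rectAdjW w q ∘ₗ rectOp q) (kerOp k)
      = (mulOp h * L - L * mulOp h) + (sAdjW w q h hc ∘ₗ rectOp q - rectAdjW w q ∘ₗ sComm120 q h hc)
        + mulOp ζ * (Dg - kerOp k) * mulOp h - mulOp ζ * p1Comm120 k h := by
  set B : Module.End ℝ (EuclideanSpace ℝ ι) := rectAdjW w q ∘ₗ rectOp q with hB
  have e2 : mulOp h * B - B * mulOp h = sAdjW w q h hc ∘ₗ rectOp q - rectAdjW w q ∘ₗ sComm120 q h hc := by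
    rw [Module.End.mul_eq_comp, Module.End.mul_eq_comp, hB]
    exact gramW_comm w q h hc
  have e4 := line4_commutator k h
  have split : mulOp h * (L + B) - (L + B) * mulOp h = (mulOp h * L - L * mulOp h) + (mulOp h * B - B * mulOp h) := by
    noncomm_ring
  simp only [kDiag]
  rw [e4, split, e2, mul_neg, ← sub_eq_add_neg]

end Lines

end Literature.MathematicalPhysics.QuantumFieldTheory.Balaban1983to89.B6Eq291Generator
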